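import Literature.MathematicalPhysics.QuantumFieldTheory.Balaban1983to89.B6RandomWalkL2Prop26Grad2KLevelV1
import Literature.MathematicalPhysics.QuantumFieldTheory.Balaban1983to89.B6Ineq2134TKFamKLevelExportV1
import Literature.MathematicalPhysics.QuantumFieldTheory.Balaban1983to89.B6KFamTransposeKLevelV1
import Literature.MathematicalPhysics.QuantumFieldTheory.Balaban1983to89.B6GDVaLegKLevelV1

/-!
# `Balaban1983to89.B6Ineq2140Grad2KLevelV1` — T. Bałaban, *Propagators and renormalization transformations for lattice gauge theories. II*,
# Commun. Math. Phys. **96** (1984) 223–250 [Balaban1984PropagatorsII], Proposition 2.6, THE `L²` ENTRIES `‖ζ∇∇GJ‖` AND `‖ζG∇*∇*J‖` OF (2.140) p. 247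
# (columns five and six, prefactor `1`) AT k LEVELS FOR THE GENUINE `G = Δ_a⁻¹` ON THE V1 TORUS — NO DISPLAYED ANALYTIC HYPOTHESIS (file 15, the capstone of
# the block-`ℓ²` bricks of `…B6RandomWalkL2`: the `L²` walk (2.141) `…B6RandomWalkL2Prop26Grad2KLevelV1` fed with the exported (2.134) families
# `…B6Ineq2134KFamKLevelExportV1` / `…B6Ineq2134TKFamKLevelExportV1` through `…B6KFamTransposeKLevelV1`)

statement-level skeleton of published theorems with citation tags; proofs where landed; nothing here is a claim about the Yang–Mills mass gap

WHAT IS PRINTED (p. 247 [PDF 25], Proposition 2.6, render `inprint/lit-balaban-p05/renders/cmp96/p25.png`): *"There exists a positive constant δ₃ depending on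
d and L only, such that … ‖ζGJ‖, ‖ζ∇GJ‖, ‖ζG∇*J‖, ‖ζ∇G∇*J‖, ‖ζ∇∇GJ‖, ‖ζG∇*∇*J‖ ≤ O(1)[(Lʲη)², Lʲη, Lʲη, 1, 1, 1]|ζ|e^{−δ₃d(y,y′)}‖J‖ (2.140) if supp ζ ⊂ Δ(y),
y ∈ Λ_j, supp J ⊂ Δ(y′), with the constant O(1) depending on d and L. The operator G can be represented as G = G₀(I − R)⁻¹ = Σ_{n=0}^∞ G₀Rⁿ = … (2.141) and
the series above is convergent in the norms appearing in the inequalities (2.136)–(2.140)."*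

CITATION HEADER (lean-in-tree rule) — WHAT IS REPRODUCED.  Phase-2 file of the `lit-balaban` typed skeleton (HOME `run/shared/lean/pub/lit-balaban/`), seat
**p22 gen 30** (free-target protocol G.5-34(d), TAKING HOME/STATUS 2026-08-24T13:26Z «block-ℓ² walk toward census (2.140)₄₋₆», cc r03 = census
`B6Prop26Census2140KLevelV1` slots hl4/hl5, p38); SKELETON row **B6.Prop2.6** × B6.Eq2.140 × B6.Eq2.141 (cells only; decls of record untouched).  IMPORTS BY
NAME, restating nothing: `prop26_2140_grad2_kLevel_of_2134T` (the `L²` walk with only the reversed (2.134) family displayed), `h2134T_kFamT_kLevel_unconditional`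
(that family, no displayed input), `hasMajorant_tr_kFam_of_reversed` (reversed product = transpose), `…B6RandomWalkL2Schur.hasL2Majorant_tr`,
`…B6GDVaLegKLevelV1.tr_DV`, `…B6OpTransposeV1.tr_onFun`, `…B6Ineq2140KLevelV1.adjoint_GE`:
* **`ineq2140_grad2_kLevel`** — ∃ σ₁ > 0, C_D ≥ 0 ∀ 0 < σ ≤ σ₁, α ∈ [0,1], N₀ ≥ 1 ∃ M₂ > 0 ∀ admissible V1 torus (`k ≥ 2`, `M_h = Lᵃ ≥ 8`, `M₂ ≤ L·M_h`, `R ≥ 2L²`,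
  `P′ ≥ 5`, `L ≥ 5`, cubes placed, the (2.59)-shape Lemma-2.1 budget `N₀ + 1 ≤ R·L·M_h`, `e^{−ασ}L^{2(d+1)/N₀} < 1`, global weight band), ∀ `c′ ≠ 0`, ∀ ν μ:
  `HasL2Majorant (geomT D) (blkV1 hN D) (∇_ν∇_μG) (2·(3·9^{d+1}·C_D)·K261 N₀ (d+1) L 1 (ασ)·e^{−(1−α)σ·d_T(y,y′)})` — (2.140)₅ with print's prefactor `1`;
* **`ineq2140_grad2_kLevel_sigma`** — the census Σ-shape (slot hl4): `Σ_x(ζ(x)·(∇_ν∇_μGJ)(x))² ≤ (A·e^{−δd_T(y,y′)}·s)²·Σ_xJ(x)²` for `supp ζ ⊂ Δ(y)`, `|ζ| ≤ s`,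
  `supp J ⊂ Δ(y′)`, operators in the `∘ₗ` form;
* **`tr_DV_DV_GE`** (`(∇_ν∇_μG)ᵀ = G∇*_μ∇*_ν`) and **`ineq2140_grad2T_kLevel`** / **`ineq2140_grad2T_kLevel_sigma`** — (2.140)₆ `‖ζG∇*∇*J‖` with the same
  constant (slot hl5), by `hasL2Majorant_tr` and the symmetry of `d_T`;
* §3 **`ineq2140_grad2_kLevel_census`** / **`ineq2140_grad2T_kLevel_census`** — r03's displayed inputs hl4 / hl5 of `B6Prop26Census2140KLevelV1` VERBATIM
  (`∃ δ A M₂ N₁, …`; `σ := σ₁`, `α := ½`, the Lemma-2.1 exponent `N₁` chosen inside by r03's `budget_lt_one`, re-proved).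
THEOREMS ONLY (no definition, no `def … : Prop`, no displayed analytic hypothesis); standard axioms.

HONEST SCOPE / DIVERGENCES.  (1) The hypotheses left are print's SETTING ((2.2): `M` large — `M₂ ≤ L·M_h`, `R ≥ 2L²`; (2.16): the weight band; Lemma 2.1's
(2.59) budget; the V1 torus with `L ≥ 5`, `P′ ≥ 5`, `k ≥ 2`, placed cubes — automatic at `L = 5`, `P′ ≥ 12` by `B6CubeWindowV1.placed_all_cubes`), not analytic
inputs.  (2) Lemma 2.1 with the torus constant `K261` (print's `c₁` refuted as printed, GAPS G-A11-1); `δ₃ = (1−α)σ`; the constant depends on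
`d, L, b₀, b₁, α, σ, N₀` — NOT on `k`, `M_h`, `c′` (the uniformity that is the point of Prop. 2.6).  (3) Unweighted `ℓ²` on the fine bonds, lattice units.
(4) The mixed entry `‖ζ∇G∇*J‖` ((2.140)₄) is NOT reached by this route (GAPS G-B6-2140-456).  Nothing on d = 4 or the continuum; NOT summit progress.
Unit `lit-balaban-p22` (gen 30), 2026-08-24.
-/

noncomputable section

open scoped BigOperators
open Finset

namespace Literature.MathematicalPhysics.QuantumFieldTheory.Balaban1983to89.B6Ineq2140Grad2KLevelV1

open LatticeFieldCalculus
open B6MultiLevelBoxOperator (N0)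
open B6MultiLevelTorusOperator (TDomains)
open B6Cover236MultiLevelBlocks (cubes)
open B6Geom246MultiLevelTorus (geomT)
open B6RandomWalk (HasMajorant)
open B6RandomWalkL2 (HasL2Majorant hasL2Majorant_mono sum_sq_cut_apply_le_of_hasL2Majorant)
open B6RandomWalkL2Schur (hasL2Majorant_tr)
open B6RandomWalkL2Prop26Grad2KLevelV1 (prop26_2140_grad2_kLevel_of_2134T)
open B8Ineq192MultiLevelTorus (symmT)
open B6Ineq2134TKFamKLevelExportV1 (h2134T_kFamT_kLevel_unconditional)
open B6KFamTransposeKLevelV1 (hasMajorant_tr_kFam_of_reversed)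
open B6Ineq261LevelGap (K261 K261_nonneg)
open B6OpTransposeV1 (tr tr_mul tr_onFun)
open B6Ineq2133TwoScaleV1 (onFun)
open B6Ineq2140KLevelV1 (adjoint_GE)
open B6GlobalChartV1 (PV domT blkV1)
open B6SectAOperatorsV1 (BondIdx)
open B6SectAVectorModelV1 (GE)
open B6GradLegKLevelV1 (DV)
open B6LapLegKLevelV1 (DVa)
open B6GDVaLegKLevelV1 (tr_DV)
open B6CubeWindowV1 (Placed GlobalBand band_le one_le_of_eight_le four_le_of_five_le)

variable {d ℓ : ℕ} {hd : 1 ≤ d + 1} {hL : Odd (ℓ + 1) ∧ 1 < ℓ + 1} {m K : ℕ} {Mh k R : ℕ} {P' : Fin (d + 1) → ℕ}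

/-! ## §1  (2.140)₅ at k levels, no displayed analytic input -/

section Grad2

open Classical in
/-- **PROPOSITION 2.6, THE `L²` ENTRY `‖ζ∇_ν∇_μGJ‖ ≤ O(1)|ζ|e^{−δ₃d(y,y′)}‖J‖` OF (2.140) AT k LEVELS FOR THE GENUINE `G = Δ_a⁻¹` ON THE V1 TORUS — NO DISPLAYED
ANALYTIC HYPOTHESIS.**  For the weight band `[b₀, b₁]` there are `σ₁ > 0`, `C_D ≥ 0` such that for all `0 < σ ≤ σ₁`, `α ∈ [0,1]`, `N₀ ≥ 1` there is `M₂ > 0`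
with: on every admissible V1 torus (`k ≥ 2`, `M_h = Lᵃ ≥ 8`, `M₂ ≤ L·M_h`, `R ≥ 2L²`, `P′ ≥ 5`, `L ≥ 5`, cubes placed, Lemma-2.1 budget, global band), for every
`c′ ≠ 0` and all `ν, μ`: `HasL2Majorant (∇_ν∇_μG) (2·(3·9^{d+1}·C_D)·K261·e^{−(1−α)σ d_T(y,y′)})` — the `L²` walk (2.141) with BOTH (2.134) families fed by name.
[cite: Balaban1984PropagatorsII, Prop. 2.6 (2.140)–(2.141) p.247, (2.134)–(2.135) p.247, (2.91) p.239, Lemma 2.1 p.234] -/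
theorem ineq2140_grad2_kLevel (d ℓ : ℕ) (hd : 1 ≤ d + 1) (hL : Odd (ℓ + 1) ∧ 1 < ℓ + 1) {b₀ b₁ : ℝ} (hb₀ : 0 < b₀) (hb₁ : b₀ ≤ b₁) :
    ∃ σ₁ : ℝ, 0 < σ₁ ∧ ∃ CD : ℝ, 0 ≤ CD ∧ ∀ (σ : ℝ), 0 < σ → σ ≤ σ₁ → ∀ (α : ℝ), 0 ≤ α → α ≤ 1 → ∀ (N₀ : ℕ), 0 < N₀ →
    ∃ M₂ : ℝ, 0 < M₂ ∧
    ∀ (m K : ℕ) {Mh k R : ℕ} {P' : Fin (d + 1) → ℕ}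
      (hN : ∀ μ, N0 ℓ Mh k P' μ = (PV d ℓ m K hd hL).sitesPerDir 0) (D : TDomains d ℓ Mh k P' R) (hk : k ≤ m + K) (_ : 2 ≤ k)
      {a : ℕ} (_ : Mh = (ℓ + 1) ^ a) (_ : 8 ≤ Mh) (_ : 2 * (ℓ + 1) ^ 2 ≤ R) (_ : ∀ μ, 5 ≤ P' μ) (_ : 4 ≤ ℓ)
      (_ : ∀ c : ↥(cubes D.toDomains), Placed ℓ k P' c.1)
      (_ : M₂ ≤ ((ℓ : ℝ) + 1) * Mh) (_ : N₀ + 1 ≤ R * ((ℓ + 1) * Mh))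
      (_ : Real.exp (-(α * σ)) * ((ℓ : ℝ) + 1) ^ ((2 * (d + 1 : ℕ) : ℝ) / N₀) < 1)
      {cf : ℝ} (hcf : cf ≠ 0) {w : BondIdx (domT hN D hk) → ℝ} (hw : ∀ i, 0 < w i) (_ : GlobalBand b₀ b₁ cf w) (ν μ : Fin (d + 1)),
      HasL2Majorant (g := geomT D) (blkV1 hN D) (DV ν cf * DV μ cf * onFun (GE (domT hN D hk) hcf hw))
        (fun y y' => 2 * (((3 * 9 ^ (d + 1) : ℕ) : ℝ) * CD) * K261 N₀ (d + 1) ((ℓ : ℝ) + 1) 1 (α * σ) *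
          Real.exp (-((1 - α) * σ * (geomT D).dist y y'))) := by
  have ha₀ : (0 : ℝ) < b₀ / ((ℓ + 1 : ℕ) : ℝ) := by positivity
  obtain ⟨σa, hσa, CD, hCD, hI⟩ := prop26_2140_grad2_kLevel_of_2134T d ℓ hd hL hb₀ hb₁
  obtain ⟨σb, hσb, hK⟩ := h2134T_kFamT_kLevel_unconditional d ℓ hd hL hb₀ hb₁
  refine ⟨min σa σb, lt_min hσa hσb, CD, hCD, fun σ hσ hσ1 α hα0 hα1 N₀ hN₀ => ?_⟩
  obtain ⟨Ma, hMa, hI2⟩ := hI σ hσ (hσ1.trans (min_le_left _ _)) α hα0 hα1 N₀ hN₀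
  obtain ⟨Mb, hMb, hK2⟩ := hK σ hσ (hσ1.trans (min_le_right _ _)) α hα0 N₀ hN₀ (3 * 9 ^ (d + 1))
  refine ⟨max Ma Mb, lt_max_of_lt_left hMa, ?_⟩
  intro m K Mh k R P' hN D hk hk2 a hMha hM8 hR2 hP5 hℓ hpl hM hRM hθ cf hcf w hw hwb ν μ
  obtain ⟨θ₁, hθ₁, hsm, hfam⟩ := hK2 m K hN D hk hk2 hMha hM8 hR2 hP5 hℓ hpl ((le_max_right _ _).trans hM) hcf w
  exact hI2 m K hN D hk hk2 hMha hM8 hR2 hP5 hℓ hpl ((le_max_left _ _).trans hM) hRM hθ hcf hw hwb θ₁ hθ₁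
    (fun c c' => hasMajorant_tr_kFam_of_reversed hN hk (one_le_of_eight_le hM8) (four_le_of_five_le hP5) hMha
      (band_le (d := d) (ℓ := ℓ) hb₀ hb₁) ha₀ hpl w cf c c' (hfam c c'))
    hsm ν μ

open Classical in
/-- **(2.140)₅ AT k LEVELS IN THE CENSUS Σ-SHAPE** (r03's `B6Prop26Census2140KLevelV1` slot hl4, operators in the `∘ₗ` form): under the setting of
`ineq2140_grad2_kLevel`, for `supp ζ ⊂ Δ(y)`, `0 ≤ s`, `|ζ| ≤ s`, `supp J ⊂ Δ(y′)`:
`Σ_x (ζ(x)·((∇_ν ∘ ∇_μ ∘ G)J)(x))² ≤ (A·e^{−(1−α)σ·d_T(y,y′)}·s)²·Σ_x J(x)²`, `A = 2·(3·9^{d+1}·C_D)·K261 N₀ (d+1) L 1 (ασ)`.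
[cite: Balaban1984PropagatorsII, Prop. 2.6 (2.140) p.247] -/
theorem ineq2140_grad2_kLevel_sigma (d ℓ : ℕ) (hd : 1 ≤ d + 1) (hL : Odd (ℓ + 1) ∧ 1 < ℓ + 1) {b₀ b₁ : ℝ} (hb₀ : 0 < b₀) (hb₁ : b₀ ≤ b₁) :
    ∃ σ₁ : ℝ, 0 < σ₁ ∧ ∃ CD : ℝ, 0 ≤ CD ∧ ∀ (σ : ℝ), 0 < σ → σ ≤ σ₁ → ∀ (α : ℝ), 0 ≤ α → α ≤ 1 → ∀ (N₀ : ℕ), 0 < N₀ →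
    ∃ M₂ : ℝ, 0 < M₂ ∧
    ∀ (m K : ℕ) {Mh k R : ℕ} {P' : Fin (d + 1) → ℕ}
      (hN : ∀ μ, N0 ℓ Mh k P' μ = (PV d ℓ m K hd hL).sitesPerDir 0) (D : TDomains d ℓ Mh k P' R) (hk : k ≤ m + K) (_ : 2 ≤ k)
      {a : ℕ} (_ : Mh = (ℓ + 1) ^ a) (_ : 8 ≤ Mh) (_ : 2 * (ℓ + 1) ^ 2 ≤ R) (_ : ∀ μ, 5 ≤ P' μ) (_ : 4 ≤ ℓ)
      (_ : ∀ c : ↥(cubes D.toDomains), Placed ℓ k P' c.1)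
      (_ : M₂ ≤ ((ℓ : ℝ) + 1) * Mh) (_ : N₀ + 1 ≤ R * ((ℓ + 1) * Mh))
      (_ : Real.exp (-(α * σ)) * ((ℓ : ℝ) + 1) ^ ((2 * (d + 1 : ℕ) : ℝ) / N₀) < 1)
      {cf : ℝ} (hcf : cf ≠ 0) {w : BondIdx (domT hN D hk) → ℝ} (hw : ∀ i, 0 < w i) (_ : GlobalBand b₀ b₁ cf w) (ν μ : Fin (d + 1))
      (y y' : (geomT D).Site) (ζ J : PBond (PV d ℓ m K hd hL) 0 → ℝ) {s : ℝ} (_ : 0 ≤ s)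
      (_ : ∀ x, blkV1 hN D x ≠ y → ζ x = 0) (_ : ∀ x, |ζ x| ≤ s) (_ : ∀ x, blkV1 hN D x ≠ y' → J x = 0),
      ∑ x, (ζ x * (DV ν cf ∘ₗ DV μ cf ∘ₗ onFun (GE (domT hN D hk) hcf hw)) J x) ^ 2 ≤
        (2 * (((3 * 9 ^ (d + 1) : ℕ) : ℝ) * CD) * K261 N₀ (d + 1) ((ℓ : ℝ) + 1) 1 (α * σ) *
          Real.exp (-((1 - α) * σ * (geomT D).dist y y')) * s) ^ 2 * ∑ x, J x ^ 2 := by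
  obtain ⟨σ₁, hσ₁, CD, hCD, h⟩ := ineq2140_grad2_kLevel d ℓ hd hL hb₀ hb₁
  refine ⟨σ₁, hσ₁, CD, hCD, fun σ hσ hσ1 α hα0 hα1 N₀ hN₀ => ?_⟩
  obtain ⟨M₂, hM₂, h2⟩ := h σ hσ hσ1 α hα0 hα1 N₀ hN₀
  refine ⟨M₂, hM₂, ?_⟩
  intro m K Mh k R P' hN D hk hk2 a hMha hM8 hR2 hP5 hℓ hpl hM hRM hθ cf hcf w hw hwb ν μ y y' ζ J s hs hζ hζs hJ
  have hmaj := h2 m K hN D hk hk2 hMha hM8 hR2 hP5 hℓ hpl hM hRM hθ hcf hw hwb ν μ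
  have e : (DV ν cf ∘ₗ DV μ cf ∘ₗ onFun (GE (domT hN D hk) hcf hw)) = DV ν cf * DV μ cf * onFun (GE (domT hN D hk) hcf hw) := by
    rw [Module.End.mul_eq_comp, Module.End.mul_eq_comp, LinearMap.comp_assoc]
  rw [e]
  exact sum_sq_cut_apply_le_of_hasL2Majorant (g := geomT D) (blkV1 hN D) hmaj y y' ζ J hs hζ hζs hJ

end Grad2

/-! ## §2  (2.140)₆ = (2.140)₅ᵀ: `G∇*_μ∇*_ν = (∇_ν∇_μG)ᵀ` -/

section Grad2T

/-- **`(∇_ν∇_μG)ᵀ = G∇*_μ∇*_ν`**: `tr (∇_ν·∇_μ·G) = G·∇*_μ·∇*_ν` (`tr` reverses products, `tr ∇_ν = ∇*_ν` — p38's `tr_DV` —, `G` self-adjoint — `adjoint_GE`).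
[cite: Balaban1984PropagatorsII, Prop. 2.6 (2.140) p.247 (columns five/six), (2.22) p.226] -/
theorem tr_DV_DV_GE (hN : ∀ μ, N0 ℓ Mh k P' μ = (PV d ℓ m K hd hL).sitesPerDir 0) (D : TDomains d ℓ Mh k P' R) (hk : k ≤ m + K)
    {cf : ℝ} (hcf : cf ≠ 0) {w : BondIdx (domT hN D hk) → ℝ} (hw : ∀ i, 0 < w i) (ν μ : Fin (d + 1)) :
    tr (DV (P := PV d ℓ m K hd hL) ν cf * DV μ cf * onFun (GE (domT hN D hk) hcf hw)) =
      onFun (GE (domT hN D hk) hcf hw) * DVa μ cf * DVa ν cf := by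
  rw [tr_mul, tr_mul, tr_DV, tr_DV, tr_onFun, adjoint_GE, mul_assoc]

open Classical in
/-- **PROPOSITION 2.6, THE `L²` ENTRY `‖ζG∇*_μ∇*_νJ‖` OF (2.140) (column six) AT k LEVELS FOR THE GENUINE `G` — NO DISPLAYED ANALYTIC HYPOTHESIS**: the
block-`ℓ²` majorant of `ineq2140_grad2_kLevel` passes to the transpose (`…B6RandomWalkL2Schur.hasL2Majorant_tr`, `d_T` symmetric).
[cite: Balaban1984PropagatorsII, Prop. 2.6 (2.140)–(2.141) p.247] -/
theorem ineq2140_grad2T_kLevel (d ℓ : ℕ) (hd : 1 ≤ d + 1) (hL : Odd (ℓ + 1) ∧ 1 < ℓ + 1) {b₀ b₁ : ℝ} (hb₀ : 0 < b₀) (hb₁ : b₀ ≤ b₁) :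
    ∃ σ₁ : ℝ, 0 < σ₁ ∧ ∃ CD : ℝ, 0 ≤ CD ∧ ∀ (σ : ℝ), 0 < σ → σ ≤ σ₁ → ∀ (α : ℝ), 0 ≤ α → α ≤ 1 → ∀ (N₀ : ℕ), 0 < N₀ →
    ∃ M₂ : ℝ, 0 < M₂ ∧
    ∀ (m K : ℕ) {Mh k R : ℕ} {P' : Fin (d + 1) → ℕ}
      (hN : ∀ μ, N0 ℓ Mh k P' μ = (PV d ℓ m K hd hL).sitesPerDir 0) (D : TDomains d ℓ Mh k P' R) (hk : k ≤ m + K) (_ : 2 ≤ k)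
      {a : ℕ} (_ : Mh = (ℓ + 1) ^ a) (_ : 8 ≤ Mh) (_ : 2 * (ℓ + 1) ^ 2 ≤ R) (_ : ∀ μ, 5 ≤ P' μ) (_ : 4 ≤ ℓ)
      (_ : ∀ c : ↥(cubes D.toDomains), Placed ℓ k P' c.1)
      (_ : M₂ ≤ ((ℓ : ℝ) + 1) * Mh) (_ : N₀ + 1 ≤ R * ((ℓ + 1) * Mh))
      (_ : Real.exp (-(α * σ)) * ((ℓ : ℝ) + 1) ^ ((2 * (d + 1 : ℕ) : ℝ) / N₀) < 1)
      {cf : ℝ} (hcf : cf ≠ 0) {w : BondIdx (domT hN D hk) → ℝ} (hw : ∀ i, 0 < w i) (_ : GlobalBand b₀ b₁ cf w) (ν μ : Fin (d + 1)),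
      HasL2Majorant (g := geomT D) (blkV1 hN D) (onFun (GE (domT hN D hk) hcf hw) * DVa μ cf * DVa ν cf)
        (fun y y' => 2 * (((3 * 9 ^ (d + 1) : ℕ) : ℝ) * CD) * K261 N₀ (d + 1) ((ℓ : ℝ) + 1) 1 (α * σ) *
          Real.exp (-((1 - α) * σ * (geomT D).dist y y'))) := by
  obtain ⟨σ₁, hσ₁, CD, hCD, h⟩ := ineq2140_grad2_kLevel d ℓ hd hL hb₀ hb₁
  refine ⟨σ₁, hσ₁, CD, hCD, fun σ hσ hσ1 α hα0 hα1 N₀ hN₀ => ?_⟩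
  obtain ⟨M₂, hM₂, h2⟩ := h σ hσ hσ1 α hα0 hα1 N₀ hN₀
  refine ⟨M₂, hM₂, ?_⟩
  intro m K Mh k R P' hN D hk hk2 a hMha hM8 hR2 hP5 hℓ hpl hM hRM hθ cf hcf w hw hwb ν μ
  have hmaj := h2 m K hN D hk hk2 hMha hM8 hR2 hP5 hℓ hpl hM hRM hθ hcf hw hwb ν μ
  have hK0 : 0 ≤ K261 N₀ (d + 1) ((ℓ : ℝ) + 1) 1 (α * σ) := K261_nonneg (by positivity) zero_le_one
  have h' := hasL2Majorant_tr (g := geomT D) (blkV1 hN D) hmaj (fun y y' => by positivity)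
  rw [tr_DV_DV_GE] at h'
  refine hasL2Majorant_mono (g := geomT D) _ h' fun y y' => le_of_eq ?_
  simp only [symmT D y' y]

open Classical in
/-- **(2.140)₆ AT k LEVELS IN THE CENSUS Σ-SHAPE** (r03's slot hl5, operators in the `∘ₗ` form `G ∘ ∇*_μ ∘ ∇*_ν`).
[cite: Balaban1984PropagatorsII, Prop. 2.6 (2.140) p.247] -/
theorem ineq2140_grad2T_kLevel_sigma (d ℓ : ℕ) (hd : 1 ≤ d + 1) (hL : Odd (ℓ + 1) ∧ 1 < ℓ + 1) {b₀ b₁ : ℝ} (hb₀ : 0 < b₀) (hb₁ : b₀ ≤ b₁) :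
    ∃ σ₁ : ℝ, 0 < σ₁ ∧ ∃ CD : ℝ, 0 ≤ CD ∧ ∀ (σ : ℝ), 0 < σ → σ ≤ σ₁ → ∀ (α : ℝ), 0 ≤ α → α ≤ 1 → ∀ (N₀ : ℕ), 0 < N₀ →
    ∃ M₂ : ℝ, 0 < M₂ ∧
    ∀ (m K : ℕ) {Mh k R : ℕ} {P' : Fin (d + 1) → ℕ}
      (hN : ∀ μ, N0 ℓ Mh k P' μ = (PV d ℓ m K hd hL).sitesPerDir 0) (D : TDomains d ℓ Mh k P' R) (hk : k ≤ m + K) (_ : 2 ≤ k)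
      {a : ℕ} (_ : Mh = (ℓ + 1) ^ a) (_ : 8 ≤ Mh) (_ : 2 * (ℓ + 1) ^ 2 ≤ R) (_ : ∀ μ, 5 ≤ P' μ) (_ : 4 ≤ ℓ)
      (_ : ∀ c : ↥(cubes D.toDomains), Placed ℓ k P' c.1)
      (_ : M₂ ≤ ((ℓ : ℝ) + 1) * Mh) (_ : N₀ + 1 ≤ R * ((ℓ + 1) * Mh))
      (_ : Real.exp (-(α * σ)) * ((ℓ : ℝ) + 1) ^ ((2 * (d + 1 : ℕ) : ℝ) / N₀) < 1)
      {cf : ℝ} (hcf : cf ≠ 0) {w : BondIdx (domT hN D hk) → ℝ} (hw : ∀ i, 0 < w i) (_ : GlobalBand b₀ b₁ cf w) (ν μ : Fin (d + 1))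
      (y y' : (geomT D).Site) (ζ J : PBond (PV d ℓ m K hd hL) 0 → ℝ) {s : ℝ} (_ : 0 ≤ s)
      (_ : ∀ x, blkV1 hN D x ≠ y → ζ x = 0) (_ : ∀ x, |ζ x| ≤ s) (_ : ∀ x, blkV1 hN D x ≠ y' → J x = 0),
      ∑ x, (ζ x * (onFun (GE (domT hN D hk) hcf hw) ∘ₗ DVa μ cf ∘ₗ DVa ν cf) J x) ^ 2 ≤
        (2 * (((3 * 9 ^ (d + 1) : ℕ) : ℝ) * CD) * K261 N₀ (d + 1) ((ℓ : ℝ) + 1) 1 (α * σ) *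
          Real.exp (-((1 - α) * σ * (geomT D).dist y y')) * s) ^ 2 * ∑ x, J x ^ 2 := by
  obtain ⟨σ₁, hσ₁, CD, hCD, h⟩ := ineq2140_grad2T_kLevel d ℓ hd hL hb₀ hb₁
  refine ⟨σ₁, hσ₁, CD, hCD, fun σ hσ hσ1 α hα0 hα1 N₀ hN₀ => ?_⟩
  obtain ⟨M₂, hM₂, h2⟩ := h σ hσ hσ1 α hα0 hα1 N₀ hN₀
  refine ⟨M₂, hM₂, ?_⟩
  intro m K Mh k R P' hN D hk hk2 a hMha hM8 hR2 hP5 hℓ hpl hM hRM hθ cf hcf w hw hwb ν μ y y' ζ J s hs hζ hζs hJ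
  have hmaj := h2 m K hN D hk hk2 hMha hM8 hR2 hP5 hℓ hpl hM hRM hθ hcf hw hwb ν μ
  have e : (onFun (GE (domT hN D hk) hcf hw) ∘ₗ DVa μ cf ∘ₗ DVa ν cf) = onFun (GE (domT hN D hk) hcf hw) * DVa μ cf * DVa ν cf := by
    rw [Module.End.mul_eq_comp, Module.End.mul_eq_comp, LinearMap.comp_assoc]
  rw [e]
  exact sum_sq_cut_apply_le_of_hasL2Majorant (g := geomT D) (blkV1 hN D) hmaj y y' ζ J hs hζ hζs hJ

end Grad2T

/-! ## §3  The census shapes (r03's `B6Prop26Census2140KLevelV1` displayed inputs hl4, hl5 — verbatim) -/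

section Census

/-- the budget inequality `e^{−ασ}·L^{2(d+1)/N₀} < 1` holds for `N₀ := ⌈2(d+1)·log L/(ασ)⌉₊ + 1` (`α, σ > 0`, `L ≥ 1`) — r03's private `budget_lt_one`,
re-proved. [folklore] -/
private theorem budget_lt_one {d ℓ : ℕ} {α σ : ℝ} (hα : 0 < α) (hσ : 0 < σ) :
    Real.exp (-(α * σ)) * ((ℓ : ℝ) + 1) ^ ((2 * (d + 1 : ℕ) : ℝ) / (⌈2 * ((d : ℝ) + 1) * Real.log ((ℓ : ℝ) + 1) / (α * σ)⌉₊ + 1 : ℕ)) < 1 := by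
  have hL : (0 : ℝ) < (ℓ : ℝ) + 1 := by positivity
  have hlog : 0 ≤ Real.log ((ℓ : ℝ) + 1) := Real.log_nonneg (by linarith [(Nat.cast_nonneg ℓ : (0 : ℝ) ≤ ℓ)])
  have hN : 2 * ((d : ℝ) + 1) * Real.log ((ℓ : ℝ) + 1) / (α * σ) <
      ((⌈2 * ((d : ℝ) + 1) * Real.log ((ℓ : ℝ) + 1) / (α * σ)⌉₊ + 1 : ℕ) : ℝ) := by
    push_cast
    exact lt_of_le_of_lt (Nat.le_ceil _) (lt_add_one _)
  have hNpos : (0 : ℝ) < ((⌈2 * ((d : ℝ) + 1) * Real.log ((ℓ : ℝ) + 1) / (α * σ)⌉₊ + 1 : ℕ) : ℝ) := by positivity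
  have hασ : 0 < α * σ := mul_pos hα hσ
  have key : (2 * (d + 1 : ℕ) : ℝ) / (⌈2 * ((d : ℝ) + 1) * Real.log ((ℓ : ℝ) + 1) / (α * σ)⌉₊ + 1 : ℕ) * Real.log ((ℓ : ℝ) + 1) < α * σ := by
    rw [div_mul_eq_mul_div, div_lt_iff₀ hNpos]
    rw [div_lt_iff₀ hασ] at hN
    push_cast at hN ⊢
    nlinarith
  rw [Real.rpow_def_of_pos hL, ← Real.exp_add, Real.exp_lt_one_iff]
  nlinarith

open Classical in
/-- **CENSUS SLOT hl4 OF `B6Prop26Census2140KLevelV1` — VERBATIM**: the exact-block `L²` bound of `∇_ν∇_μGJ` at k levels for the genuine `G`, with `δ`, `A`, `M₂`,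
`N₁` existential and the torus hypotheses as r03 displays them (`σ := σ₁`, `α := ½`, `N₁ := ⌈4(d+1)·log L/σ₁⌉₊ + 1`).
[cite: Balaban1984PropagatorsII, Prop. 2.6 (2.140) p.247] -/
theorem ineq2140_grad2_kLevel_census (d ℓ : ℕ) (hd : 1 ≤ d + 1) (hL : Odd (ℓ + 1) ∧ 1 < ℓ + 1) {b₀ b₁ : ℝ} (hb₀ : 0 < b₀) (hb₁ : b₀ ≤ b₁) :
    ∃ (δ A M₂ : ℝ) (N₁ : ℕ), 0 < δ ∧ 0 ≤ A ∧ 0 < M₂ ∧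
      ∀ (m K : ℕ) {Mh k R : ℕ} {P' : Fin (d + 1) → ℕ}
        (hN : ∀ μ, N0 ℓ Mh k P' μ = (PV d ℓ m K hd hL).sitesPerDir 0) (D : TDomains d ℓ Mh k P' R) (hk : k ≤ m + K) (_ : 2 ≤ k)
        {a : ℕ} (_ : Mh = (ℓ + 1) ^ a) (_ : 8 ≤ Mh) (_ : 2 * (ℓ + 1) ^ 2 ≤ R) (_ : ∀ μ, 5 ≤ P' μ) (_ : 4 ≤ ℓ)
        (_ : ∀ c : ↥(cubes D.toDomains), Placed ℓ k P' c.1) (_ : M₂ ≤ ((ℓ : ℝ) + 1) * Mh) (_ : N₁ + 1 ≤ R * ((ℓ + 1) * Mh))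
        {cf : ℝ} (hcf : cf ≠ 0) {w : BondIdx (domT hN D hk) → ℝ} (hw : ∀ i, 0 < w i) (_ : GlobalBand b₀ b₁ cf w)
        (ν μ : Fin (d + 1)) (y y' : (geomT D).Site) (ζ J : PBond (PV d ℓ m K hd hL) 0 → ℝ) {s : ℝ} (_ : 0 ≤ s)
        (_ : ∀ x, blkV1 hN D x ≠ y → ζ x = 0) (_ : ∀ x, |ζ x| ≤ s) (_ : ∀ x, blkV1 hN D x ≠ y' → J x = 0),
        ∑ x, (ζ x * (DV ν cf ∘ₗ DV μ cf ∘ₗ onFun (GE (domT hN D hk) hcf hw)) J x) ^ 2 ≤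
          (A * Real.exp (-(δ * (geomT D).dist y y')) * s) ^ 2 * ∑ x, J x ^ 2 := by
  obtain ⟨σ₁, hσ₁, CD, hCD, h⟩ := ineq2140_grad2_kLevel_sigma d ℓ hd hL hb₀ hb₁
  have hhalf0 : (0 : ℝ) < 1 / 2 := by norm_num
  obtain ⟨M₂, hM₂, h2⟩ := h σ₁ hσ₁ le_rfl (1 / 2) hhalf0.le (by norm_num)
    (⌈2 * ((d : ℝ) + 1) * Real.log ((ℓ : ℝ) + 1) / (1 / 2 * σ₁)⌉₊ + 1) (Nat.succ_pos _)
  have hK0 : 0 ≤ K261 (⌈2 * ((d : ℝ) + 1) * Real.log ((ℓ : ℝ) + 1) / (1 / 2 * σ₁)⌉₊ + 1) (d + 1) ((ℓ : ℝ) + 1) 1 (1 / 2 * σ₁) :=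
    K261_nonneg (by positivity) zero_le_one
  refine ⟨(1 - 1 / 2) * σ₁, 2 * (((3 * 9 ^ (d + 1) : ℕ) : ℝ) * CD) *
      K261 (⌈2 * ((d : ℝ) + 1) * Real.log ((ℓ : ℝ) + 1) / (1 / 2 * σ₁)⌉₊ + 1) (d + 1) ((ℓ : ℝ) + 1) 1 (1 / 2 * σ₁), M₂,
    ⌈2 * ((d : ℝ) + 1) * Real.log ((ℓ : ℝ) + 1) / (1 / 2 * σ₁)⌉₊ + 1, by positivity, by positivity, hM₂, ?_⟩
  intro m K Mh k R P' hN D hk hk2 a hMha hM8 hR2 hP5 hℓ hpl hM hRM cf hcf w hw hwb ν μ y y' ζ J s hs hζ hζs hJ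
  exact h2 m K hN D hk hk2 hMha hM8 hR2 hP5 hℓ hpl hM hRM (budget_lt_one hhalf0 hσ₁) hcf hw hwb ν μ y y' ζ J hs hζ hζs hJ

open Classical in
/-- **CENSUS SLOT hl5 OF `B6Prop26Census2140KLevelV1` — VERBATIM**: the exact-block `L²` bound of `G∇*_ν∇*_μJ` at k levels for the genuine `G`
(`ineq2140_grad2T_kLevel_sigma` at the swapped pair `(μ, ν)`; `σ := σ₁`, `α := ½`). [cite: Balaban1984PropagatorsII, Prop. 2.6 (2.140) p.247] -/
theorem ineq2140_grad2T_kLevel_census (d ℓ : ℕ) (hd : 1 ≤ d + 1) (hL : Odd (ℓ + 1) ∧ 1 < ℓ + 1) {b₀ b₁ : ℝ} (hb₀ : 0 < b₀) (hb₁ : b₀ ≤ b₁) :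
    ∃ (δ A M₂ : ℝ) (N₁ : ℕ), 0 < δ ∧ 0 ≤ A ∧ 0 < M₂ ∧
      ∀ (m K : ℕ) {Mh k R : ℕ} {P' : Fin (d + 1) → ℕ}
        (hN : ∀ μ, N0 ℓ Mh k P' μ = (PV d ℓ m K hd hL).sitesPerDir 0) (D : TDomains d ℓ Mh k P' R) (hk : k ≤ m + K) (_ : 2 ≤ k)
        {a : ℕ} (_ : Mh = (ℓ + 1) ^ a) (_ : 8 ≤ Mh) (_ : 2 * (ℓ + 1) ^ 2 ≤ R) (_ : ∀ μ, 5 ≤ P' μ) (_ : 4 ≤ ℓ)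
        (_ : ∀ c : ↥(cubes D.toDomains), Placed ℓ k P' c.1) (_ : M₂ ≤ ((ℓ : ℝ) + 1) * Mh) (_ : N₁ + 1 ≤ R * ((ℓ + 1) * Mh))
        {cf : ℝ} (hcf : cf ≠ 0) {w : BondIdx (domT hN D hk) → ℝ} (hw : ∀ i, 0 < w i) (_ : GlobalBand b₀ b₁ cf w)
        (ν μ : Fin (d + 1)) (y y' : (geomT D).Site) (ζ J : PBond (PV d ℓ m K hd hL) 0 → ℝ) {s : ℝ} (_ : 0 ≤ s)
        (_ : ∀ x, blkV1 hN D x ≠ y → ζ x = 0) (_ : ∀ x, |ζ x| ≤ s) (_ : ∀ x, blkV1 hN D x ≠ y' → J x = 0),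
        ∑ x, (ζ x * (onFun (GE (domT hN D hk) hcf hw) ∘ₗ DVa ν cf ∘ₗ DVa μ cf) J x) ^ 2 ≤
          (A * Real.exp (-(δ * (geomT D).dist y y')) * s) ^ 2 * ∑ x, J x ^ 2 := by
  obtain ⟨σ₁, hσ₁, CD, hCD, h⟩ := ineq2140_grad2T_kLevel_sigma d ℓ hd hL hb₀ hb₁
  have hhalf0 : (0 : ℝ) < 1 / 2 := by norm_num
  obtain ⟨M₂, hM₂, h2⟩ := h σ₁ hσ₁ le_rfl (1 / 2) hhalf0.le (by norm_num)
    (⌈2 * ((d : ℝ) + 1) * Real.log ((ℓ : ℝ) + 1) / (1 / 2 * σ₁)⌉₊ + 1) (Nat.succ_pos _)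
  have hK0 : 0 ≤ K261 (⌈2 * ((d : ℝ) + 1) * Real.log ((ℓ : ℝ) + 1) / (1 / 2 * σ₁)⌉₊ + 1) (d + 1) ((ℓ : ℝ) + 1) 1 (1 / 2 * σ₁) :=
    K261_nonneg (by positivity) zero_le_one
  refine ⟨(1 - 1 / 2) * σ₁, 2 * (((3 * 9 ^ (d + 1) : ℕ) : ℝ) * CD) *
      K261 (⌈2 * ((d : ℝ) + 1) * Real.log ((ℓ : ℝ) + 1) / (1 / 2 * σ₁)⌉₊ + 1) (d + 1) ((ℓ : ℝ) + 1) 1 (1 / 2 * σ₁), M₂,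
    ⌈2 * ((d : ℝ) + 1) * Real.log ((ℓ : ℝ) + 1) / (1 / 2 * σ₁)⌉₊ + 1, by positivity, by positivity, hM₂, ?_⟩
  intro m K Mh k R P' hN D hk hk2 a hMha hM8 hR2 hP5 hℓ hpl hM hRM cf hcf w hw hwb ν μ y y' ζ J s hs hζ hζs hJ
  exact h2 m K hN D hk hk2 hMha hM8 hR2 hP5 hℓ hpl hM hRM (budget_lt_one hhalf0 hσ₁) hcf hw hwb μ ν y y' ζ J hs hζ hζs hJ

end Census

end Literature.MathematicalPhysics.QuantumFieldTheory.Balaban1983to89.B6Ineq2140Grad2KLevelV1
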